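import Summits.PneNP.PneNP.Theorems.SymmetryBudgetNoHiddenOrderProgramSrcsC
import Summits.PneNP.PneNP.Theorems.SymmetryBudgetNoHiddenOrderProgramSrcsBSym
import Summits.PneNP.PneNP.Theorems.SymmetryBudgetNoHiddenOrderFLabOfLab

/-!
# `NoHiddenOrder` (stmt-PneNP-14781), (R2c) VI: the window canoniser program — source equivariance of the value shapes

Route `PneNP/SymmetryBudget`; companion of `…ProgramSrcsC.lean` (seat -1).  Under the wire map `Sum.map π (Gt.perm ρ σ)`:
the candidate / part labels move with the label (`candLab_relabel`, `partLab_relabel`, through `ofLab_cand_relabel` /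
`ofLab_part_relabel`), hence so do the EXTERNAL wires (`map_cdOKW`, `map_cdValW`, `map_cdOkW`, `map_cdBitW`, `map_ptOkW`, `map_ptBitW`),
the lifted value wires (`map_orLW`) and the pasted value wires (`map_awW`); the guard is invariant (`orGuard_relabel_iff`); the kinds are
invariant (`orKind_relabel`, `andKind_relabel`); and the SOURCE SETS are equivariant:
`orSrcs_image : (orSrcs L g).image (Sum.map π (Gt.perm ρ σ)) = orSrcs (FLab.relabel σ L) (g.relabel σ)`, `andSrcs_image`, `vlSrcs_image`.
Sorry-free; supports stmt-PneNP-14781, does not close it.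
-/

set_option linter.dupNamespace false -- `Summit.PneNP.PneNP.…` (D-0017 single-conjunct layout)

namespace Summit.PneNP.PneNP.Theorems

open Finset CGBits BranchSum Literature.Computability.Complexity Literature.Computability.Complexity.SymProg

namespace WCanon

variable {m : ℕ} (π : Fin m × Fin m → Fin m × Fin m) (ρ : Equiv.Perm (Fin m)) (σ : Equiv.Perm (WV m))

/-! ### Candidate and part labels -/

/-- The label of the scheme underlying `L`, componentwise. -/
theorem toLab_eq (L : FLab m) : toLab L = ⟨lU L, lX L, lLam L⟩ := rfl

/-- **The candidate labels move with the label.** [folklore] -/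
theorem candLab_relabel (L : FLab m) (κ : WV m × Fin (wn m)) :
    candLab (FLab.relabel σ L) (cκ σ κ) = (candLab L κ).map (FLab.relabel σ) := by
  unfold candLab
  simp only [cκ_fst, cκ_snd, lX_relabel, mem_fs]
  split_ifs with h
  · rfl
  · rw [toLab_relabel, ofLab_cand_relabel]

/-- **The part labels move with the label.** [folklore] -/
theorem partLab_relabel (L : FLab m) (U' : Finset (WV m)) :
    partLab (FLab.relabel σ L) (fs σ U') = (partLab L U').map (FLab.relabel σ) := by
  unfold partLab
  simp only [lU_relabel, fs_mem_partSets_iff]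
  split_ifs with h
  · rw [toLab_relabel, ← ofLab_part_relabel]; rfl
  · rfl

/-! ### External wires -/

/-- The "candidate decodes" wires are equivariant. [folklore] -/
theorem map_cdOKW (L : FLab m) (κ : WV m × Fin (wn m)) :
    Sum.map π (Gt.perm ρ σ) (cdOKW L κ) = cdOKW (FLab.relabel σ L) (cκ σ κ) := by
  unfold cdOKW
  rw [candLab_relabel]
  cases candLab L κ <;> rfl

/-- The candidate colour wires are equivariant. [folklore] -/
theorem map_cdValW (L : FLab m) (κ : WV m × Fin (wn m)) (w : WV m) (c : Fin (wn m)) :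
    Sum.map π (Gt.perm ρ σ) (cdValW L κ w c) = cdValW (FLab.relabel σ L) (cκ σ κ) (σ w) c := by
  unfold cdValW
  rw [candLab_relabel]
  cases candLab L κ with
  | none => rfl
  | some Lc => exact map_valW π ρ σ Lc _ w c

/-- The "candidate has a value" wires are equivariant. [folklore] -/
theorem map_cdOkW (L : FLab m) (κ : WV m × Fin (wn m)) :
    Sum.map π (Gt.perm ρ σ) (cdOkW L κ) = cdOkW (FLab.relabel σ L) (cκ σ κ) := by
  unfold cdOkW
  rw [candLab_relabel]
  cases candLab L κ <;> rfl

/-- The candidate value-bit wires are equivariant. [folklore] -/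
theorem map_cdBitW (L : FLab m) (κ : WV m × Fin (wn m)) (b : Fin (NB (wn m))) :
    Sum.map π (Gt.perm ρ σ) (cdBitW L κ b) = cdBitW (FLab.relabel σ L) (cκ σ κ) b := by
  unfold cdBitW
  rw [candLab_relabel]
  cases candLab L κ <;> rfl

/-- The "part has a value" wires are equivariant. [folklore] -/
theorem map_ptOkW (L : FLab m) (U' : Finset (WV m)) :
    Sum.map π (Gt.perm ρ σ) (ptOkW L U') = ptOkW (FLab.relabel σ L) (fs σ U') := by
  unfold ptOkW
  rw [partLab_relabel]
  cases partLab L U' <;> rfl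

/-- The part value-bit wires are equivariant. [folklore] -/
theorem map_ptBitW (L : FLab m) (U' : Finset (WV m)) (b : Fin (NB (wn m))) :
    Sum.map π (Gt.perm ρ σ) (ptBitW L U' b) = ptBitW (FLab.relabel σ L) (fs σ U') b := by
  unfold ptBitW
  rw [partLab_relabel]
  cases partLab L U' <;> rfl

/-- The lifted value wires are equivariant. [folklore] -/
theorem map_orLW (L : FLab m) (κ : WV m × Fin (wn m)) (b : Fin (NB (wn m))) :
    Sum.map π (Gt.perm ρ σ) (orLW L κ b) = orLW (FLab.relabel σ L) (cκ σ κ) b := by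
  unfold orLW liftWire
  split
  · rfl
  · exact map_cdBitW π ρ σ L κ _

/-- The pasted value wires are equivariant. [folklore] -/
theorem map_awW (L : FLab m) (b : Fin (NB (wn m))) : Sum.map π (Gt.perm ρ σ) (awW L b) = awW (FLab.relabel σ L) b := by
  unfold awW; split <;> rfl

/-- The reachability wires are equivariant. [folklore] -/
theorem map_reachW (L : FLab m) (u w : WV m) : Sum.map π (Gt.perm ρ σ) (reachW L u w) = reachW (FLab.relabel σ L) (σ u) (σ w) := rfl

/-! ### The guard -/

/-- **The guard of a candidate is invariant.** [folklore] -/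
theorem orGuard_relabel_iff (L : FLab m) (κ : WV m × Fin (wn m)) : OrGuard (FLab.relabel σ L) (cκ σ κ) ↔ OrGuard L κ := by
  unfold OrGuard
  simp only [cκ_fst, cκ_snd, lU_relabel, lX_relabel, mem_fs]
  have h : (⟨lU (FLab.relabel σ L), lX (FLab.relabel σ L), lLam (FLab.relabel σ L)⟩ : CertifiedLabels.Label (WV m)).cand (σ κ.1) κ.2 =
      ((⟨lU L, lX L, lLam L⟩ : CertifiedLabels.Label (WV m)).cand κ.1 κ.2).relabel σ := by
    rw [CertifiedLabels.Label.relabel_cand]; rfl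
  simp only [lU_relabel, lX_relabel] at h
  rw [h]
  unfold admW
  rw [admB_relabel_label]

/-! ### Kinds -/

/-- **The kind of the value shape at an individualisation node is invariant.** [folklore] -/
theorem orKind_relabel (L : FLab m) (g : OrGate m) : orKind (FLab.relabel σ L) (g.relabel σ) = orKind L g := by
  cases g <;> simp only [orKind, OrGate.relabel, riKind_relabel, voKind_relabel, orGuard_relabel_iff]

/-- **The kind of the value shape at a section node is invariant.** [folklore] -/
theorem andKind_relabel (g : AndGate m) : andKind (g.relabel σ) = andKind g := by
  cases g <;> simp only [andKind, AndGate.relabel, vaKind_relabel, mem_fs, card_fs]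

/-! ### The source sets -/

/-- The wire map on an internal gate. -/
theorem map_inr (g : Gt m) : Sum.map π (Gt.perm ρ σ) (Sum.inr g) = Sum.inr (g.relabel ρ σ) := rfl

/-- The image of an image over parts × a fixed index set, reindexed. [folklore] -/
theorem image_image_partSets_prod {τ β γ : Type*} [DecidableEq τ] [DecidableEq β] [DecidableEq γ] (U : Finset (WV m)) (T : Finset τ)
    (f : Finset (WV m) × τ → β) (F : β → γ) (f' : Finset (WV m) × τ → γ) (h : ∀ U' t, F (f (U', t)) = f' (fs σ U', t)) :
    ((partSets U ×ˢ T).image f).image F = (partSets (fs σ U) ×ˢ T).image f' := by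
  have hm : (partSets U ×ˢ T).image (fun z => (fs σ z.1, z.2)) = partSets (fs σ U) ×ˢ T := by
    ext ⟨V, t⟩
    simp only [mem_image, mem_product, Prod.mk.injEq, partSets_fs]
    constructor
    · rintro ⟨⟨U', t'⟩, ⟨hU', ht'⟩, rfl, rfl⟩
      exact ⟨⟨U', hU', rfl⟩, ht'⟩
    · rintro ⟨⟨U', hU', rfl⟩, ht⟩
      exact ⟨⟨U', t⟩, ⟨hU', ht⟩, rfl, rfl⟩
  rw [← hm, Finset.image_image, Finset.image_image]
  exact congrArg (fun g : Finset (WV m) × τ → γ => (partSets U ×ˢ T).image g) (funext fun a => h a.1 a.2 : F ∘ f = f' ∘ _)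

/-- **Source equivariance of the value shape at an individualisation node.** [folklore] -/
theorem orSrcs_image (L : FLab m) (g : OrGate m) :
    (orSrcs L g).image (Sum.map π (Gt.perm ρ σ)) = orSrcs (FLab.relabel σ L) (g.relabel σ) := by
  cases g with
  | ltx y u v =>
    simp only [orSrcs, OrGate.relabel, ne_eq, EmbeddingLike.apply_eq_iff_eq]
    split_ifs <;> simp only [image_insert, image_singleton, map_inr, Gt.relabel, AnGate.relabel]
  | eqx y u v =>
    simp only [orSrcs, OrGate.relabel, EmbeddingLike.apply_eq_iff_eq]
    split_ifs <;> simp only [image_singleton, map_inr, Gt.relabel, AnGate.relabel]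
  | rv y g =>
    simp only [orSrcs, OrGate.relabel]
    exact riSrcs_image _ σ (orRIIn L y) (orRIIn (FLab.relabel σ L) (σ y)) _ _ (fun _ => rfl) (map_memW π ρ σ L _)
      (map_adjWire' π ρ σ) (fun _ _ => rfl) (fun _ _ => rfl) g
  | bothc κ w c =>
    simp only [orSrcs, OrGate.relabel, image_insert, image_singleton, map_cdValW, map_inr, Gt.relabel, OrGate.relabel, RIGate.relabel, cκ_fst]
  | nonec κ w c =>
    simp only [orSrcs, OrGate.relabel, image_insert, image_singleton, map_cdValW, map_inr, Gt.relabel, OrGate.relabel, RIGate.relabel, cκ_fst]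
  | xnc κ w c => simp only [orSrcs, OrGate.relabel, image_insert, image_singleton, map_inr, Gt.relabel, OrGate.relabel]
  | eqc κ =>
    simp only [orSrcs, OrGate.relabel, image_insert, map_cdOKW]
    congr 1
    exact image_image_univ_cκ σ _ _ _ (fun wc => rfl)
  | kept κ =>
    simp only [orSrcs, OrGate.relabel, orGuard_relabel_iff]
    split_ifs
    · simp only [image_insert, image_singleton, map_inr, Gt.relabel, AnGate.relabel, OrGate.relabel, map_cdOkW, cκ_fst]
    · rfl
  | cmu y c' c u =>
    simp only [orSrcs, OrGate.relabel, image_insert, image_singleton, map_memW, map_valW, map_inr, Gt.relabel, OrGate.relabel,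
      RIGate.relabel]
  | cm y c' c =>
    simp only [orSrcs, OrGate.relabel]
    exact image_image_univ_equiv σ _ _ _ (fun u => rfl)
  | lc κ i c' c => simp only [orSrcs, OrGate.relabel, image_insert, image_singleton, map_cdBitW, map_inr, Gt.relabel, OrGate.relabel, cκ_fst]
  | liftC κ i c =>
    simp only [orSrcs, OrGate.relabel]
    exact image_image_congr _ _ _ _ (fun c' => rfl)
  | vc g =>
    simp only [orSrcs, OrGate.relabel]
    exact voSrcs_image _ σ (orLW L) (orLW (FLab.relabel σ L)) _ _ (fun _ => rfl) (map_orLW π ρ σ L) g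
  | beat κ' κ => simp only [orSrcs, OrGate.relabel, image_insert, image_singleton, map_inr, Gt.relabel, OrGate.relabel, VOGate.relabel]
  | nbeat κ' κ => simp only [orSrcs, OrGate.relabel, image_singleton, map_inr, Gt.relabel, OrGate.relabel]
  | best κ =>
    simp only [orSrcs, OrGate.relabel, image_insert, map_inr, Gt.relabel, OrGate.relabel]
    congr 1
    exact image_image_univ_cκ σ _ _ _ (fun κ' => rfl)
  | orOk =>
    simp only [orSrcs, OrGate.relabel]
    exact image_image_univ_cκ σ _ _ _ (fun κ => rfl)
  | ob κ b => simp only [orSrcs, OrGate.relabel, image_insert, image_singleton, map_inr, Gt.relabel, OrGate.relabel, map_orLW]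
  | orBit b =>
    simp only [orSrcs, OrGate.relabel]
    exact image_image_univ_cκ σ _ _ _ (fun κ => rfl)

/-- **Source equivariance of the value shape at a section node.** [folklore] -/
theorem andSrcs_image (L : FLab m) (g : AndGate m) :
    (andSrcs L g).image (Sum.map π (Gt.perm ρ σ)) = andSrcs (FLab.relabel σ L) (g.relabel σ) := by
  cases g with
  | nreach u w => simp only [andSrcs, AndGate.relabel, image_singleton, map_reachW]
  | partAt u U' =>
    simp only [andSrcs, AndGate.relabel, image_union]
    congr 1
    · exact image_image_fs σ U' _ _ _ (map_reachW π ρ σ L u)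
    · conv_rhs => rw [← fs_univ σ, ← fs_sdiff]
      exact image_image_fs σ (univ \ U') _ _ _ (fun w => rfl)
  | isPart U' =>
    simp only [andSrcs, AndGate.relabel, lU_relabel, fs_mem_partSets_iff]
    split_ifs
    · exact image_image_fs σ U' _ _ _ (fun u => rfl)
    · rfl
  | nisPart U' => simp only [andSrcs, AndGate.relabel, image_singleton, map_inr, Gt.relabel, AndGate.relabel]
  | imp U' => simp only [andSrcs, AndGate.relabel, image_insert, image_singleton, map_inr, Gt.relabel, AndGate.relabel, map_ptOkW]
  | andOk =>
    simp only [andSrcs, AndGate.relabel, lU_relabel]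
    exact image_image_partSets σ (lU L) _ _ _ (fun U' => rfl)
  | vc g =>
    simp only [andSrcs, AndGate.relabel]
    exact vaSrcs_image _ σ (ptBitW L) (ptBitW (FLab.relabel σ L)) _ _ (fun _ => rfl) (map_ptBitW π ρ σ L) g
  | pg U' U'' u =>
    simp only [andSrcs, AndGate.relabel, mem_fs]
    split_ifs
    · simp only [image_insert, image_singleton, map_inr, Gt.relabel, AndGate.relabel, VAGate.relabel]
    · rfl
  | cntGe U' t =>
    simp only [andSrcs, AndGate.relabel, lU_relabel]
    exact image_image_partSets_product_univ σ (lU L) _ _ _ (fun U'' u => rfl)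
  | ncntGe U' t => simp only [andSrcs, AndGate.relabel, image_singleton, map_inr, Gt.relabel, AndGate.relabel]
  | cntIs U' t => simp only [andSrcs, AndGate.relabel, image_insert, image_singleton, map_inr, Gt.relabel, AndGate.relabel]
  | eqp U' U'' => simp only [andSrcs, AndGate.relabel, image_insert, image_singleton, map_inr, Gt.relabel, AndGate.relabel, VAGate.relabel]
  | multGe U' q =>
    simp only [andSrcs, AndGate.relabel, lU_relabel]
    exact image_image_partSets σ (lU L) _ _ _ (fun U'' => rfl)
  | rowSrc i U' t =>
    simp only [andSrcs, AndGate.relabel, card_fs]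
    split_ifs
    · simp only [image_insert, image_singleton, map_inr, Gt.relabel, AndGate.relabel]
    · rfl
  | pcb i c U' t o =>
    simp only [andSrcs, AndGate.relabel, card_fs]
    split_ifs
    · simp only [image_insert, image_singleton, map_inr, Gt.relabel, AndGate.relabel, map_ptBitW]
    · rfl
  | pCol i c =>
    simp only [andSrcs, AndGate.relabel, lU_relabel]
    exact image_image_partSets_prod σ (lU L) _ _ _ _ (fun U' t => rfl)
  | scp i j U' t =>
    simp only [andSrcs, AndGate.relabel, card_fs]
    split_ifs
    · simp only [image_insert, image_singleton, map_inr, Gt.relabel, AndGate.relabel]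
    · rfl
  | sameCopy i j =>
    simp only [andSrcs, AndGate.relabel, lU_relabel]
    exact image_image_partSets_prod σ (lU L) _ _ _ _ (fun U' t => rfl)
  | nsame i j => simp only [andSrcs, AndGate.relabel, image_singleton, map_inr, Gt.relabel, AndGate.relabel]
  | pab i j U' t o o' =>
    simp only [andSrcs, AndGate.relabel, card_fs]
    split_ifs
    · simp only [image_insert, image_singleton, map_inr, Gt.relabel, AndGate.relabel, map_ptBitW]
    · rfl
  | pOwn i j =>
    simp only [andSrcs, AndGate.relabel, lU_relabel]
    exact image_image_partSets_prod σ (lU L) _ _ _ _ (fun U' t => rfl)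
  | swu c c' u w =>
    simp only [andSrcs, AndGate.relabel, image_insert, image_singleton, map_memW, map_valW, map_inr, Gt.relabel, AnGate.relabel]
  | swcc c c' =>
    simp only [andSrcs, AndGate.relabel]
    exact image_image_univ_pair σ _ _ _ (fun uw => rfl)
  | xcp i j c c' => simp only [andSrcs, AndGate.relabel, image_insert, image_singleton, map_inr, Gt.relabel, AndGate.relabel]
  | xc i j =>
    simp only [andSrcs, AndGate.relabel]
    exact image_image_congr _ _ _ _ (fun cc => rfl)
  | pX i j => simp only [andSrcs, AndGate.relabel, image_insert, image_singleton, map_inr, Gt.relabel, AndGate.relabel]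
  | pAdj i j => simp only [andSrcs, AndGate.relabel, image_insert, image_singleton, map_inr, Gt.relabel, AndGate.relabel]

/-- **Source equivariance of the output gates of a value.** [folklore] -/
theorem vlSrcs_image (L : FLab m) (g : VlGate m) :
    (vlSrcs L g).image (Sum.map π (Gt.perm ρ σ)) = vlSrcs (FLab.relabel σ L) g := by
  cases g with
  | ndead => simp only [vlSrcs, image_singleton, map_deadW]
  | decOK => simp only [vlSrcs, image_insert, image_singleton, map_inr, Gt.relabel, AnGate.relabel]
  | a1 => simp only [vlSrcs, image_insert, image_singleton, map_inr, Gt.relabel, AnGate.relabel, AndGate.relabel]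
  | a2 => simp only [vlSrcs, image_insert, image_singleton, map_inr, Gt.relabel, AnGate.relabel, OrGate.relabel]
  | okk => simp only [vlSrcs, image_insert, image_singleton, map_inr, Gt.relabel]
  | ok =>
    simp only [vlSrcs, lU_relabel, card_fs]
    split_ifs <;> simp only [image_insert, image_singleton, map_inr, Gt.relabel]
  | b1 b => simp only [vlSrcs, image_insert, image_singleton, map_inr, Gt.relabel, AnGate.relabel, AndGate.relabel, map_awW]
  | b2 b => simp only [vlSrcs, image_insert, image_singleton, map_inr, Gt.relabel, AnGate.relabel, OrGate.relabel]
  | bb b => simp only [vlSrcs, image_insert, image_singleton, map_inr, Gt.relabel]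
  | bit b =>
    simp only [vlSrcs, lU_relabel, card_fs]
    split_ifs with h1
    · rw [image_insert, map_inr]
      congr 1
      split
      · split_ifs
        · exact image_image_fs σ (lU L) _ _ _ (fun u => map_valW π ρ σ L _ u _)
        · rfl
      · rfl
    · simp only [image_insert, image_singleton, map_inr, Gt.relabel]

end WCanon

end Summit.PneNP.PneNP.Theorems
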